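import Literature.Analysis.Matrix.GramSchmidtComplexStructure
import Literature.Analysis.Matrix.GramSchmidtNearIdentity
import Literature.Algebra.EuclideanLattices.GramSchmidtTablePrefix
import HarnessLib

/-!
# Exact Gram–Schmidt orthonormalisation of a Gaussian-integer matrix through Cohen's integer table

Topic `Analysis/Matrix`; glue between `GramSchmidtNearIdentity.lean` (the column-normalised
Gram–Schmidt matrix `gsUnit B = B* · diag(‖b*ₖ‖⁻¹)` of a complex matrix),
`GramSchmidtComplexStructure.lean` (complex Gram–Schmidt = real Gram–Schmidt of the doubled
realified family, `realify_gramSchmidt`) and `Algebra/EuclideanLattices/GramSchmidtTablePrefix.lean`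
(Cohen's INTEGER recursion `uRec` on an integer family with an independent prefix computes
`dₖ ⟪bᵢ, b*ₖ⟫`, `uRec_cast_eq_gramDet_mul_inner`). Written for the reduction machine of the
discharge of Aaronson–Arkhipov's Thm. 1.3
(`Literature.Computability.QuantumComplexity.gpeSolvableInFBPPRel_NPRel_of_approxBosonSamplingOracle`),
which must hand an approximate-BosonSampling oracle the `b`-bit roundings of the entries of an
EXACTLY column-orthonormal matrix `U = gsUnit B` built from a matrix `B` of Gaussian integers:

* `gaussIntMatrix B` — the complex matrix of `B : Matrix (Fin m) (Fin n) (ℤ × ℤ)`;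
* `extFamily B : Fin (2n + (m+m)) → ℤ^{m+m}` — the realified columns interleaved with their
  `i`-multiples (`reCol`, `imCol`), followed by the standard basis vectors; its real picture is
  `extReal B = Fin.append (dbl mulI (realify ∘ colVec)) (single · 1)` (`cast_extFamily`);
* `linearIndependent_dblReal` — `ℂ`-independent columns give an `ℝ`-independent doubled family
  (the prefix on which Cohen's recursion is exact);
* **`uRec_extFamily_eq`** — for independent columns, `c < n`, `t < m + m`:
  `u_{2c}(2n + t, 2c) = d_{2c} · (realify b*_c)_t`, with `d_{2c} = dRec (2c) > 0`;
* **`norm_gramSchmidt_sq_eq_dRec_div`** — `‖b*_c‖² = d_{2c+1} / d_{2c}`;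
* **`gsUnit_re_eq` / `gsUnit_im_eq`** — `re U_{rc} = u / √(d_{2c} d_{2c+1})` with the integer
  `u = u_{2c}(2n + r, 2c)` (and `im` with the row `2n + m + r`): every entry of `U` is an integer
  over the square root of a product of two positive integers of the table, so that its rounding
  is an integer computation (`Analysis/SpecialFunctions/IntegerRoundSqrt.lean`).

All proved; no new facts.

## References

* H. Cohen, *A Course in Computational Algebraic Number Theory*, GTM 138, Springer 1993, §2.6.3
  (integral Gram–Schmidt: `dᵢ`, `λᵢⱼ = dⱼ μᵢⱼ ∈ ℤ`) and Algorithm 2.6.7.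
* S. Aaronson, A. Arkhipov, *The computational complexity of linear optics*, Theory of Computing 9
  (2013) 143–252, §5.2 (p. 192: "`A` … obtained by Gram–Schmidt orthonormalisation").
-/

noncomputable section

namespace Literature.Analysis.Matrix

open Finset InnerProductSpace Literature.Algebra.EuclideanLattices
open scoped _root_.Matrix ComplexConjugate

variable {m n : ℕ}

/-! ### The Gaussian-integer matrix and its integer families -/

/-- The complex matrix with Gaussian-integer entries `(z₁, z₂) ↦ z₁ + z₂ i`. [folklore] -/
def gaussIntMatrix (B : _root_.Matrix (Fin m) (Fin n) (ℤ × ℤ)) : _root_.Matrix (Fin m) (Fin n) ℂ :=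
  _root_.Matrix.of fun r k => ((B r k).1 : ℂ) + ((B r k).2 : ℂ) * Complex.I

/-- The realified column `k`: real parts, then imaginary parts (as integers). [folklore] -/
def reCol (B : _root_.Matrix (Fin m) (Fin n) (ℤ × ℤ)) (k : Fin n) : Fin (m + m) → ℤ :=
  fun t => Sum.elim (fun r => (B r k).1) (fun r => (B r k).2) (finSumFinEquiv.symm t)

/-- The realification of `i ·` column `k`: `(-im, re)`. [folklore] -/
def imCol (B : _root_.Matrix (Fin m) (Fin n) (ℤ × ℤ)) (k : Fin n) : Fin (m + m) → ℤ :=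
  fun t => Sum.elim (fun r => -(B r k).2) (fun r => (B r k).1) (finSumFinEquiv.symm t)

/-- The doubled integer family `(reCol 0, imCol 0, reCol 1, imCol 1, …)`. [folklore] -/
def dblCols (B : _root_.Matrix (Fin m) (Fin n) (ℤ × ℤ)) (l : Fin (2 * n)) : Fin (m + m) → ℤ :=
  if l.val % 2 = 0 then reCol B ⟨l.val / 2, by omega⟩ else imCol B ⟨l.val / 2, by omega⟩

/-- The standard basis vector `eₜ ∈ ℤ^{m+m}`. [folklore] -/
def stdVec (t : Fin (m + m)) : Fin (m + m) → ℤ := fun s => if s = t then 1 else 0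

/-- **The extended family** handed to Cohen's recursion: the doubled realified columns followed by
the standard basis of `ℤ^{m+m}`. [folklore] -/
def extFamily (B : _root_.Matrix (Fin m) (Fin n) (ℤ × ℤ)) : Fin (2 * n + (m + m)) → (Fin (m + m) → ℤ) :=
  Fin.append (dblCols B) stdVec

/-- The real picture of the doubled columns: `dbl mulI (realify ∘ colVec)`. [folklore] -/
def dblReal (B : _root_.Matrix (Fin m) (Fin n) (ℤ × ℤ)) : Fin (2 * n) → EuclideanSpace ℝ (Fin (m + m)) :=
  dbl mulI fun k => realify (colVec (gaussIntMatrix B) k)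

/-- The real picture of the extended family. [folklore] -/
def extReal (B : _root_.Matrix (Fin m) (Fin n) (ℤ × ℤ)) :
    Fin (2 * n + (m + m)) → EuclideanSpace ℝ (Fin (m + m)) :=
  Fin.append (dblReal B) fun t => EuclideanSpace.single t (1 : ℝ)

/-- Casting `reCol` gives `realify` of the column. [folklore] -/
theorem cast_reCol (B : _root_.Matrix (Fin m) (Fin n) (ℤ × ℤ)) (k : Fin n) :
    (intVecToEuclidean (m + m)) (reCol B k) = realify (colVec (gaussIntMatrix B) k) := by
  refine ext_sum (fun r => ?_) (fun r => ?_)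
  · rw [realify_inl]
    change ((reCol B k (finSumFinEquiv (Sum.inl r)) : ℤ) : ℝ) = _
    simp only [reCol, Equiv.symm_apply_apply, Sum.elim_inl]
    simp [colVec, gaussIntMatrix]
  · rw [realify_inr]
    change ((reCol B k (finSumFinEquiv (Sum.inr r)) : ℤ) : ℝ) = _
    simp only [reCol, Equiv.symm_apply_apply, Sum.elim_inr]
    simp [colVec, gaussIntMatrix]

/-- Casting `imCol` gives `mulI` of `realify` of the column. [folklore] -/
theorem cast_imCol (B : _root_.Matrix (Fin m) (Fin n) (ℤ × ℤ)) (k : Fin n) :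
    (intVecToEuclidean (m + m)) (imCol B k) = mulI (realify (colVec (gaussIntMatrix B) k)) := by
  refine ext_sum (fun r => ?_) (fun r => ?_)
  · rw [mulI_inl, realify_inr]
    change ((imCol B k (finSumFinEquiv (Sum.inl r)) : ℤ) : ℝ) = _
    simp only [imCol, Equiv.symm_apply_apply, Sum.elim_inl]
    simp [colVec, gaussIntMatrix]
  · rw [mulI_inr, realify_inl]
    change ((imCol B k (finSumFinEquiv (Sum.inr r)) : ℤ) : ℝ) = _
    simp only [imCol, Equiv.symm_apply_apply, Sum.elim_inr]
    simp [colVec, gaussIntMatrix]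

/-- Casting the doubled integer family gives the doubled real family. [folklore] -/
theorem cast_dblCols (B : _root_.Matrix (Fin m) (Fin n) (ℤ × ℤ)) (l : Fin (2 * n)) :
    (intVecToEuclidean (m + m)) (dblCols B l) = dblReal B l := by
  unfold dblCols dblReal dbl
  split_ifs with h
  · exact cast_reCol B _
  · exact cast_imCol B _

/-- Casting a standard basis vector gives `EuclideanSpace.single`. [folklore] -/
theorem cast_stdVec (t : Fin (m + m)) :
    (intVecToEuclidean (m + m)) (stdVec t) = EuclideanSpace.single t (1 : ℝ) := by
  ext s
  change ((stdVec t s : ℤ) : ℝ) = _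
  by_cases h : s = t
  · subst h; simp [stdVec]
  · simp [stdVec, h]

/-- **The integer extended family casts to the real one.** [folklore] -/
theorem cast_extFamily (B : _root_.Matrix (Fin m) (Fin n) (ℤ × ℤ)) :
    ⇑(intVecToEuclidean (m + m)).toAddMonoidHom ∘ extFamily B = extReal B := by
  funext i
  change (intVecToEuclidean (m + m)) (extFamily B i) = extReal B i
  unfold extFamily extReal
  refine Fin.addCases (fun l => ?_) (fun t => ?_) i
  · rw [Fin.append_left, Fin.append_left, cast_dblCols]
  · rw [Fin.append_right, Fin.append_right, cast_stdVec]

/-- The prefix of the extended family is the doubled family. [folklore] -/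
theorem extReal_comp_castLE (B : _root_.Matrix (Fin m) (Fin n) (ℤ × ℤ)) :
    extReal B ∘ Fin.castLE (Nat.le_add_right (2 * n) (m + m)) = dblReal B := by
  funext l
  have : Fin.castLE (Nat.le_add_right (2 * n) (m + m)) l = Fin.castAdd (m + m) l := Fin.ext rfl
  rw [Function.comp_apply, this, extReal, Fin.append_left]

/-- The prefix of the integer extended family is the doubled integer family. [folklore] -/
theorem extFamily_comp_castLE (B : _root_.Matrix (Fin m) (Fin n) (ℤ × ℤ)) :
    extFamily B ∘ Fin.castLE (Nat.le_add_right (2 * n) (m + m)) = dblCols B := by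
  funext l
  have : Fin.castLE (Nat.le_add_right (2 * n) (m + m)) l = Fin.castAdd (m + m) l := Fin.ext rfl
  rw [Function.comp_apply, this, extFamily, Fin.append_left]

/-! ### Independence of the doubled family -/

/-- Sums over `Fin (2n)` pair up along `evenIdx`/`oddIdx`. [folklore] -/
theorem sum_univ_dbl {M : Type*} [AddCommMonoid M] (F : Fin (2 * n) → M) :
    ∑ l, F l = ∑ i : Fin n, (F (evenIdx i) + F (oddIdx i)) := by
  have hbij : Function.Bijective (Sum.elim (evenIdx (n := n)) oddIdx) := by
    constructor
    · rintro (i | i) (j | j) h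
      · simp only [Sum.elim_inl] at h
        have := congrArg Fin.val h; simp [evenIdx] at this; rw [Fin.ext this]
      · simp only [Sum.elim_inl, Sum.elim_inr] at h
        have := congrArg Fin.val h; simp [evenIdx, oddIdx] at this; omega
      · simp only [Sum.elim_inl, Sum.elim_inr] at h
        have := congrArg Fin.val h; simp [evenIdx, oddIdx] at this; omega
      · simp only [Sum.elim_inr] at h
        have := congrArg Fin.val h; simp [oddIdx] at this; rw [Fin.ext this]
    · intro l
      obtain ⟨i, h | h⟩ := eq_evenIdx_or_oddIdx l
      · exact ⟨Sum.inl i, h.symm⟩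
      · exact ⟨Sum.inr i, h.symm⟩
  rw [← Fintype.sum_bijective _ hbij (fun s => F (Sum.elim evenIdx oddIdx s)) F (fun _ => rfl),
    Fintype.sum_sum_type]
  simp only [Sum.elim_inl, Sum.elim_inr, Finset.sum_add_distrib]

/-- `realify` is injective. [folklore] -/
theorem realify_injective : Function.Injective (realify (m := m)) := by
  intro u v h
  have : realify (u - v) = 0 := by rw [realify_sub, h, sub_self]
  have hn : ‖u - v‖ = 0 := by rw [← norm_realify, this, norm_zero]
  exact sub_eq_zero.1 (norm_eq_zero.1 hn)

/-- **`ℂ`-independent columns give an `ℝ`-independent doubled realified family** (a real relation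
`∑ a₂ᵢ realify gᵢ + a₂ᵢ₊₁ mulI (realify gᵢ) = 0` is `realify (∑ (a₂ᵢ + a₂ᵢ₊₁ i) gᵢ) = 0`).
[folklore] -/
theorem linearIndependent_dblReal (B : _root_.Matrix (Fin m) (Fin n) (ℤ × ℤ))
    (hli : LinearIndependent ℂ (colVec (gaussIntMatrix B))) : LinearIndependent ℝ (dblReal B) := by
  rw [Fintype.linearIndependent_iff]
  intro a ha l
  set g := colVec (gaussIntMatrix B) with hg
  -- the real relation is `realify` of a complex relation
  have hsum : ∑ l, a l • dblReal B l =
      realify (∑ i : Fin n, ((a (evenIdx i) : ℂ) + (a (oddIdx i) : ℂ) * Complex.I) • g i) := by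
    rw [realify_sum, sum_univ_dbl]
    refine Finset.sum_congr rfl fun i _ => ?_
    rw [realify_smul, dblReal, dbl_evenIdx, dbl_oddIdx]
    congr 1
    · congr 1; simp
    · congr 1; simp
  rw [hsum, ← realify_zero] at ha
  have hrel := realify_injective ha
  have hc := Fintype.linearIndependent_iff.1 hli (fun i => (a (evenIdx i) : ℂ) + (a (oddIdx i) : ℂ) * Complex.I) hrel
  obtain ⟨i, h | h⟩ := eq_evenIdx_or_oddIdx l
  · have := congrArg Complex.re (hc i)
    simp at this
    rw [h]; exact this
  · have := congrArg Complex.im (hc i)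
    simp at this
    rw [h]; exact this

/-- The independence hypothesis of `GramSchmidtTablePrefix.lean` for the extended family. [folklore] -/
theorem linearIndependent_extFamily_prefix (B : _root_.Matrix (Fin m) (Fin n) (ℤ × ℤ))
    (hli : LinearIndependent ℂ (colVec (gaussIntMatrix B))) :
    LinearIndependent ℝ (⇑(intVecToEuclidean (m + m)).toAddMonoidHom ∘
      (extFamily B ∘ Fin.castLE (Nat.le_add_right (2 * n) (m + m)))) := by
  rw [extFamily_comp_castLE]
  have : ⇑(intVecToEuclidean (m + m)).toAddMonoidHom ∘ dblCols B = dblReal B :=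
    funext fun l => cast_dblCols B l
  rw [this]
  exact linearIndependent_dblReal B hli

/-! ### Reading the table -/

/-- The Gram–Schmidt vectors of the extended family at the prefix indices are those of the doubled
family, i.e. the realified complex Gram–Schmidt vectors at even indices. [folklore] -/
theorem gramSchmidt_extReal_evenIdx (B : _root_.Matrix (Fin m) (Fin n) (ℤ × ℤ)) (c : Fin n) :
    gramSchmidt ℝ (extReal B) (Fin.castLE (Nat.le_add_right (2 * n) (m + m)) (evenIdx c)) =
      realify (gramSchmidt ℂ (colVec (gaussIntMatrix B)) c) := by
  rw [← gramSchmidt_comp_castLE (extReal B) (Nat.le_add_right (2 * n) (m + m)) (evenIdx c),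
    extReal_comp_castLE, realify_gramSchmidt]
  rfl

/-- The integer `d_{l}` of the table is the Gram determinant of the doubled real family, for
`l ≤ 2n`. [folklore] -/
theorem dRec_extFamily_eq (B : _root_.Matrix (Fin m) (Fin n) (ℤ × ℤ))
    (hli : LinearIndependent ℂ (colVec (gaussIntMatrix B))) (l : ℕ) (hl : l ≤ 2 * n) :
    (dRec (extFamily B) l : ℝ) = gramDet (dblReal B) l hl := by
  rw [dRec_cast_eq_gramDet_of_prefix (extFamily B) (Nat.le_add_right (2 * n) (m + m))
    (linearIndependent_extFamily_prefix B hli) l hl, cast_extFamily,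
    ← gramDet_comp_castLE (extReal B) (Nat.le_add_right (2 * n) (m + m)) l hl, extReal_comp_castLE]

/-- `d_l > 0` for `l ≤ 2n`. [folklore] -/
theorem dRec_extFamily_pos (B : _root_.Matrix (Fin m) (Fin n) (ℤ × ℤ))
    (hli : LinearIndependent ℂ (colVec (gaussIntMatrix B))) (l : ℕ) (hl : l ≤ 2 * n) :
    0 < dRec (extFamily B) l := by
  have h := gramDet_pos (linearIndependent_dblReal B hli) l hl
  rw [← dRec_extFamily_eq B hli l hl] at h
  exact_mod_cast h

/-- **The table entry in the row of `eₜ` at level and column `2c` is `d_{2c}` times the `t`-th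
coordinate of the realified Gram–Schmidt vector `b*_c`.** [cite: Cohen1993, §2.6.3 and Algorithm 2.6.7] -/
theorem uRec_extFamily_eq (B : _root_.Matrix (Fin m) (Fin n) (ℤ × ℤ))
    (hli : LinearIndependent ℂ (colVec (gaussIntMatrix B))) (c : Fin n) (t : Fin (m + m)) :
    (uRec (extFamily B) (2 * c) (Fin.natAdd (2 * n) t) ⟨2 * c, by omega⟩ : ℝ) =
      dRec (extFamily B) (2 * c) * realify (gramSchmidt ℂ (colVec (gaussIntMatrix B)) c) t := by
  have hk : 2 * (c : ℕ) < 2 * n := by omega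
  have h := uRec_cast_eq_gramDet_mul_inner (extFamily B) (Nat.le_add_right (2 * n) (m + m))
    (linearIndependent_extFamily_prefix B hli) hk (Fin.natAdd (2 * n) t)
  rw [h, dRec_extFamily_eq B hli (2 * c) hk.le, cast_extFamily,
    ← gramDet_comp_castLE (extReal B) (Nat.le_add_right (2 * n) (m + m)) (2 * c) hk.le,
    extReal_comp_castLE]
  congr 1
  have hidx : (⟨2 * c, lt_of_lt_of_le hk (Nat.le_add_right (2 * n) (m + m))⟩ : Fin (2 * n + (m + m))) =
      Fin.castLE (Nat.le_add_right (2 * n) (m + m)) (evenIdx c) := Fin.ext rfl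
  rw [hidx, gramSchmidt_extReal_evenIdx]
  have he : extReal B (Fin.natAdd (2 * n) t) = EuclideanSpace.single t (1 : ℝ) := by
    rw [extReal, Fin.append_right]
  change inner ℝ (extReal B (Fin.natAdd (2 * n) t)) _ = _
  rw [he, EuclideanSpace.inner_single_left]
  simp

/-- **`‖b*_c‖² = d_{2c+1} / d_{2c}`** (the real doubled family has `‖f*_{2c}‖ = ‖realify b*_c‖ = ‖b*_c‖`
and `d_{2c+1} = d_{2c} ‖f*_{2c}‖²`). [cite: Cohen1993, §2.6.3] -/
theorem norm_gramSchmidt_sq_eq_dRec_div (B : _root_.Matrix (Fin m) (Fin n) (ℤ × ℤ))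
    (hli : LinearIndependent ℂ (colVec (gaussIntMatrix B))) (c : Fin n) :
    ‖gramSchmidt ℂ (colVec (gaussIntMatrix B)) c‖ ^ 2 =
      (dRec (extFamily B) (2 * c + 1) : ℝ) / dRec (extFamily B) (2 * c) := by
  have hk : 2 * (c : ℕ) < 2 * n := by omega
  have hd := dRec_extFamily_pos B hli (2 * c) hk.le
  rw [eq_div_iff (by exact_mod_cast hd.ne'), dRec_extFamily_eq B hli (2 * c + 1) hk,
    dRec_extFamily_eq B hli (2 * c) hk.le]
  have hs : gramDet (dblReal B) (2 * c + 1) hk =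
      gramDet (dblReal B) (2 * c) hk.le * ‖gramSchmidt ℝ (dblReal B) (evenIdx c)‖ ^ 2 :=
    gramDet_succ (dblReal B) (evenIdx c)
  rw [hs, mul_comm]
  congr 1
  rw [← norm_realify, realify_gramSchmidt]
  rfl

/-! ### Entries of `gsUnit` as integer quotients -/

/-- The row index of `re` of row `r` in the extended family: `2n + r`. [folklore] -/
def reRow (m n : ℕ) (r : Fin m) : Fin (2 * n + (m + m)) := Fin.natAdd (2 * n) (finSumFinEquiv (Sum.inl r))

/-- The row index of `im` of row `r` in the extended family: `2n + m + r`. [folklore] -/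
def imRow (m n : ℕ) (r : Fin m) : Fin (2 * n + (m + m)) := Fin.natAdd (2 * n) (finSumFinEquiv (Sum.inr r))

/-- The algebra of the normalisation: `(u/d) / √(d'/d) = u / √(d d')` for `d > 0`. [folklore] -/
theorem div_div_sqrt_div {u d d' : ℝ} (hd : 0 < d) (hd' : 0 ≤ d') :
    u / d / Real.sqrt (d' / d) = u / Real.sqrt (d * d') := by
  have hden : d * Real.sqrt (d' / d) = Real.sqrt (d * d') := by
    rw [eq_comm, Real.sqrt_eq_iff_mul_self_eq (by positivity) (by positivity)]
    have h := Real.mul_self_sqrt (show 0 ≤ d' / d by positivity)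
    symm
    calc d * Real.sqrt (d' / d) * (d * Real.sqrt (d' / d))
        = d * d * (Real.sqrt (d' / d) * Real.sqrt (d' / d)) := by ring
      _ = d * d * (d' / d) := by rw [h]
      _ = d * d' := by field_simp
  rw [div_div, hden]

/-- **Real parts of the entries of `U = gsUnit B`**: `re U_{rc} = u / √(d_{2c} d_{2c+1})` with the
table integer `u = u_{2c}(2n + r, 2c)`. [cite: Cohen1993, §2.6.3 and Algorithm 2.6.7] -/
theorem gsUnit_re_eq (B : _root_.Matrix (Fin m) (Fin n) (ℤ × ℤ))
    (hli : LinearIndependent ℂ (colVec (gaussIntMatrix B))) (r : Fin m) (c : Fin n) :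
    (gsUnit (gaussIntMatrix B) r c).re =
      (uRec (extFamily B) (2 * c) (reRow m n r) ⟨2 * c, by omega⟩ : ℝ) /
        Real.sqrt ((dRec (extFamily B) (2 * c) : ℝ) * dRec (extFamily B) (2 * c + 1)) := by
  have hk : 2 * (c : ℕ) < 2 * n := by omega
  have hd := dRec_extFamily_pos B hli (2 * c) hk.le
  have hd' := dRec_extFamily_pos B hli (2 * c + 1) hk
  have hdR : (0 : ℝ) < dRec (extFamily B) (2 * c) := by exact_mod_cast hd
  have hu := uRec_extFamily_eq B hli c (finSumFinEquiv (Sum.inl r))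
  rw [realify_inl] at hu
  -- `re (b*_c r) = u / d`
  have hre : (gramSchmidt ℂ (colVec (gaussIntMatrix B)) c r).re =
      (uRec (extFamily B) (2 * c) (reRow m n r) ⟨2 * c, by omega⟩ : ℝ) / dRec (extFamily B) (2 * c) := by
    rw [eq_div_iff hdR.ne', mul_comm]
    exact hu.symm
  have hnorm : ‖gramSchmidt ℂ (colVec (gaussIntMatrix B)) c‖ =
      Real.sqrt ((dRec (extFamily B) (2 * c + 1) : ℝ) / dRec (extFamily B) (2 * c)) := by
    rw [← norm_gramSchmidt_sq_eq_dRec_div B hli c, Real.sqrt_sq (norm_nonneg _)]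
  rw [gsUnit, _root_.Matrix.of_apply, gsMatrix, _root_.Matrix.of_apply, Complex.div_ofReal_re, hre,
    hnorm, div_div_sqrt_div hdR (by exact_mod_cast hd'.le)]

/-- **Imaginary parts of the entries of `U = gsUnit B`**: `im U_{rc} = u / √(d_{2c} d_{2c+1})` with
the table integer `u = u_{2c}(2n + m + r, 2c)`. [cite: Cohen1993, §2.6.3 and Algorithm 2.6.7] -/
theorem gsUnit_im_eq (B : _root_.Matrix (Fin m) (Fin n) (ℤ × ℤ))
    (hli : LinearIndependent ℂ (colVec (gaussIntMatrix B))) (r : Fin m) (c : Fin n) :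
    (gsUnit (gaussIntMatrix B) r c).im =
      (uRec (extFamily B) (2 * c) (imRow m n r) ⟨2 * c, by omega⟩ : ℝ) /
        Real.sqrt ((dRec (extFamily B) (2 * c) : ℝ) * dRec (extFamily B) (2 * c + 1)) := by
  have hk : 2 * (c : ℕ) < 2 * n := by omega
  have hd := dRec_extFamily_pos B hli (2 * c) hk.le
  have hd' := dRec_extFamily_pos B hli (2 * c + 1) hk
  have hdR : (0 : ℝ) < dRec (extFamily B) (2 * c) := by exact_mod_cast hd
  have hu := uRec_extFamily_eq B hli c (finSumFinEquiv (Sum.inr r))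
  rw [realify_inr] at hu
  have him : (gramSchmidt ℂ (colVec (gaussIntMatrix B)) c r).im =
      (uRec (extFamily B) (2 * c) (imRow m n r) ⟨2 * c, by omega⟩ : ℝ) / dRec (extFamily B) (2 * c) := by
    rw [eq_div_iff hdR.ne', mul_comm]
    exact hu.symm
  have hnorm : ‖gramSchmidt ℂ (colVec (gaussIntMatrix B)) c‖ =
      Real.sqrt ((dRec (extFamily B) (2 * c + 1) : ℝ) / dRec (extFamily B) (2 * c)) := by
    rw [← norm_gramSchmidt_sq_eq_dRec_div B hli c, Real.sqrt_sq (norm_nonneg _)]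
  rw [gsUnit, _root_.Matrix.of_apply, gsMatrix, _root_.Matrix.of_apply, Complex.div_ofReal_im, him,
    hnorm, div_div_sqrt_div hdR (by exact_mod_cast hd'.le)]

end Literature.Analysis.Matrix
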